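import Literature.AlgebraicGeometry.HodgeTheory.HardLefschetzProducts
import Literature.AlgebraicGeometry.HodgeTheory.MotivatedClassesTransport
import Literature.AlgebraicGeometry.HodgeTheory.DivisorCupRaisesGeometricConiveau
import Literature.Algebra.Lie.LefschetzModuleTensorFactor
import HarnessLib

/-!
# The product class restricts to its factors, and hard Lefschetz of `pr_Y^* η + pr_Z^* η'` forces hard Lefschetz of
# the factors (Looijenga–Lunts §1, converse of `M' ⊠ M''`; Birkenhake–Lange §5.3)

Family `hodge`, lane `lit-hodgefound` (Track 2 foundations library), layer `Literature/AlgebraicGeometry/HodgeTheory`,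
namespace `Literature.AlgebraicGeometry.HodgeTheory`; prover seat `lit-hodgefound-p21` (generation 36, row g36-#3), sequel
of `HodgeTheory/HardLefschetzProducts` (g36-#1: hard Lefschetz and polarization classes are STABLE under `×`).  Here the
CONVERSE direction: the class `θ = pr_Y^* η + pr_Z^* η'` of `Y × Z` determines `η` and `η'` back (restriction to the
slices `Y × {z₀}`, `{y₀} × Z`), and hard Lefschetz of `θ` together with hard Lefschetz of ONE factor forces hard Lefschetz
of the other.  THEOREMS ONLY (no definition, no named fact, no instance; D-0026 net debt `0`).

## Sources, VERBATIM

* E. Looijenga, V. A. Lunts, *A Lie algebra attached to a projective variety*, Invent. Math. **129** (1997) [LooijengaLunts1997],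
  §1 (1.1) p. 4 (held `paper:arxiv-alg-geom_9604014` p0004 L1–L5, L62–L63, L70–L76): «`e` has the Lefschetz property if
  for all integers `k ≥ 0`, `eᵏ` maps `M_{-k}` isomorphically onto `M_k`», «The collection of Lefschetz modules is closed
  under direct sums, tensor products and taking duals», «`(𝔞' × 𝔞'', M' ⊠ M'')`,
  `e_{(a',a'')}(m' ⊗ m'') = e_{a'} m' ⊗ m'' + m' ⊗ e_{a''} m''`».  The CONVERSE in one factor («a tensor factor of a
  Lefschetz module is a Lefschetz module», read off the Clebsch–Gordan rule; no proof printed) is the tree's abstract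
  `Algebra.Lie.HasLefschetzProperty.of_tensor` (file `Algebra/Lie/LefschetzModuleTensorFactor`).
* Ch. Birkenhake, H. Lange, *Complex Abelian Varieties* (1992) [LangeBirkenhake1992], §5.3 (the polarization
  `p₁^* L₁ ⊗ p₂^* L₂` of `A₁ × A₂` restricts to `Lᵢ` on the factors `A₁ × {0}`, `{0} × A₂`).
* A. Hatcher, *Algebraic Topology* (2002) [HatcherAT2002], §3.2 Thm. 3.16 (Künneth) and §3.1 p. 199 (a constant map
  kills positive-degree cohomology: the dimension axiom).
* Y. André, *Pour une théorie inconditionnelle des motifs*, Publ. Math. IHÉS **83** (1996) [Andre1996Motifs], §1.1 p. 10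
  («`X` vérifie le théorème de Lefschetz fort … si pour tout `i ≤ d`, `L^{d-i}` est un isomorphisme»), §1.3 p. 12.

## WHAT IS PROVED (`Y`, `Z` smooth projective of dimensions `m`, `n`; `η ∈ H²(Y(ℂ); ℂ)`, `η' ∈ H²(Z(ℂ); ℂ)`;
## `θ = pr_Y^* η + pr_Z^* η'`)

* §1 SLICES: for a section `z₀ : 𝟙 ⟶ Z` and the slice `ι = (id, z₀) : Y ⟶ Y × Z` (`Motives.sliceLeft`),
  `complexBetti_map_sliceLeft_map_fst` (`ι^* pr_Y^* a = a`), `complexBetti_map_sliceLeft_map_snd` (`ι^* pr_Z^* b = 0` in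
  positive degree), **`complexBetti_map_sliceLeft_map_fst_add_map_snd`** (`ι^* θ = η`); symmetrically for
  `(y₀, id) : Z ⟶ Y × Z` (`Motives.sliceRight`); `nonempty_unitHom_of_isSmoothProjective` (a smooth projective variety has a section `𝟙 ⟶ Z`).
  Hence `θ` DETERMINES `η` and `η'` (`eq_of_map_fst_add_map_snd_eq`).
* §2 THE ONE-FACTOR CONVERSE OF HARD LEFSCHETZ: **`hasHardLefschetzProperty_of_map_fst_add_map_snd_left`** — if `θ` has
  the hard Lefschetz property in dimension `m + n` and `η'` has it in dimension `n`, then `η` has it in dimension `m`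
  (`Algebra.Lie.HasLefschetzProperty.of_tensor` on `H*(Y) ⊗ H*(Z)`, reached from `H*(Y × Z)` through `kunnethEquiv⁻¹`);
  **`…_right`** (the mirror statement, through the braiding `Y × Z ≅ Z × Y`); the `iff` forms
  `hasHardLefschetzProperty_map_fst_add_map_snd_iff_left/right`, and `complexBetti_map_braiding_map_fst_add_map_snd`
  (`β^*(pr_Z^* η' + pr_Y^* η) = pr_Y^* η + pr_Z^* η'`).
* §3 POLARIZATION CLASSES: **`IsPolarizationClass.of_tensor_left`** — if `θ` is a polarization class of `Y × Z` (dimension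
  `m + n`) and `η'` has the hard Lefschetz property in dimension `n`, then `η` is a polarization class of `Y` (rational and
  divisorial as the restriction `ι^* θ` — `IsRationalClass.pullback`, `map_mem_algebraicClasses_one` — hard Lefschetz by §2);
  `…_right`; `isPolarizationClass_map_fst_add_map_snd_iff` (for `η'` a polarization class: `θ` is one iff `η` is one).
* §0 `nontrivial_totalCohomology_complexPoints` (`H*(Z(ℂ); ℂ) ≠ 0`: `1 ≠ 0` in `H⁰` of the path-connected `Z(ℂ)`).

## SCOPE / NOT HERE

The full converse «`θ` hard Lefschetz ⇒ both factors hard Lefschetz» without a hypothesis on the other factor is not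
asserted (the abstract lemma needs the other factor to be a Lefschetz module).  Ampleness is not discussed.

## References

* [LooijengaLunts1997] E. Looijenga, V. A. Lunts, Invent. Math. 129 (1997), §1 (1.1) p. 4 L1–L5, L62–L76.
* [LangeBirkenhake1992] Ch. Birkenhake, H. Lange, *Complex Abelian Varieties* (1992), §5.3.
* [HatcherAT2002] A. Hatcher, *Algebraic Topology* (2002), §3.1 p. 199, §3.2 Thm. 3.16.
* [Andre1996Motifs] Y. André, Publ. Math. IHÉS 83 (1996), §1.1 (p. 10), §1.3 (p. 12).
* [CattaniElZeinGriffithsLe2014] E. Cattani, App. A of *Hodge Theory* (Math. Notes 49, 2014), Def. A.2.5.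
-/

noncomputable section

open CategoryTheory MonoidalCategory CartesianMonoidalCategory BraidedCategory
open scoped TensorProduct
open Literature.AlgebraicTopology.SingularHomology
open Literature.AlgebraicGeometry.Motives
open Literature.AlgebraicGeometry.Hyperkaehler
open Literature.Geometry.Kaehler
open Literature.Algebra.Lie

namespace Literature.AlgebraicGeometry.HodgeTheory

variable {m n : ℕ} {Y Z : SchemeOver ℂ}

/-! ### §0 `H*(Z(ℂ); ℂ) ≠ 0` -/

section Nontrivial

/-- **`H*(Z(ℂ); ℂ)` is a non-trivial vector space** for `Z` smooth projective: `Z(ℂ)` is a (path-)connected compact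
manifold, so `H⁰(Z(ℂ); ℂ) = ℂ · 1 ≠ 0`. [cite: HatcherAT2002, §3.1 p. 199 (H⁰ of a path-connected space)] -/
theorem nontrivial_totalCohomology_complexPoints (hZ : IsSmoothProjective n Z) :
    Nontrivial (totalCohomology ℂ (ComplexPoints Z)) := by
  letI := hZ.chartedSpace
  haveI := connectedSpace_complexPoints hZ
  haveI : LocallyPathConnectedSpace (ComplexPoints Z) :=
    ChartedSpace.locallyPathConnectedSpace (EuclideanSpace ℝ (Fin (2 * n))) (ComplexPoints Z)
  haveI : PathConnectedSpace (ComplexPoints Z) := pathConnectedSpace_iff_connectedSpace.mpr ‹_›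
  have h1 : (singularCohomologyZeroEquiv ℂ ℂ (ComplexPoints Z)).symm 1 ≠ 0 :=
    (singularCohomologyZeroEquiv ℂ ℂ (ComplexPoints Z)).symm.map_ne_zero_iff.2 one_ne_zero
  refine ⟨⟨ofDegree ℂ (ComplexPoints Z) 0 ((singularCohomologyZeroEquiv ℂ ℂ (ComplexPoints Z)).symm 1), 0, fun h0 ↦ h1 ?_⟩⟩
  exact DirectSum.of_injective (β := fun k ↦ complexBetti Z k) 0 (by rw [← DirectSum.lof_eq_of ℂ, map_zero]; exact h0)

end Nontrivial

/-! ### §1 Slices: `(id, z₀)^*(pr_Y^* η + pr_Z^* η') = η`, `(y₀, id)^*(pr_Y^* η + pr_Z^* η') = η'` -/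

section Slices

/-- **A smooth projective complex variety has a rational point over `ℂ`**, as a section `𝟙 ⟶ Z` of the terminal object
(`Z(ℂ)` is non-empty, being connected; `AlgPoints.toUnitHom`). [cite: HatcherAT2002, §3.1 p. 199] -/
theorem nonempty_unitHom_of_isSmoothProjective (hZ : IsSmoothProjective n Z) : Nonempty (𝟙_ (SchemeOver ℂ) ⟶ Z) := by
  haveI := connectedSpace_complexPoints hZ
  obtain ⟨P⟩ := (inferInstance : Nonempty (ComplexPoints Z))
  exact ⟨AlgPoints.toUnitHom P⟩

/-- `(id, z₀)^* pr_Y^* a = a` on `Hⁱ(Y(ℂ); ℂ)` (`pr_Y ∘ (id, z₀) = id`). [cite: HatcherAT2002, §3.2 Thm. 3.16 (p. 219)] -/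
theorem complexBetti_map_sliceLeft_map_fst (z₀ : 𝟙_ (SchemeOver ℂ) ⟶ Z) (i : ℕ) (a : complexBetti Y i) :
    complexBetti.map (sliceLeft Y z₀) i (complexBetti.map (fst Y Z) i a) = a := by
  rw [← CategoryTheory.comp_apply, ← complexBetti.map_comp]
  unfold Motives.sliceLeft
  rw [lift_fst, complexBetti.map_id]
  rfl

/-- `(id, z₀)^* pr_Z^* b = 0` on `Hⁱ(Z(ℂ); ℂ)` for `i ≠ 0` (`pr_Z ∘ (id, z₀)` is constant, and a constant map kills
positive-degree cohomology). [cite: HatcherAT2002, §3.1 p. 199 (dimension axiom)] -/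
theorem complexBetti_map_sliceLeft_map_snd (z₀ : 𝟙_ (SchemeOver ℂ) ⟶ Z) {i : ℕ} (hi : i ≠ 0) (b : complexBetti Z i) :
    complexBetti.map (sliceLeft Y z₀) i (complexBetti.map (snd Y Z) i b) = 0 := by
  rw [← CategoryTheory.comp_apply]
  change (singularCohomology.map ℂ ℂ (AlgPoints.mapContinuous (L := ℂ) (snd Y Z)) i ≫
      singularCohomology.map ℂ ℂ (AlgPoints.mapContinuous (L := ℂ) (sliceLeft Y z₀)) i) b = 0
  rw [← singularCohomology.map_comp, mapContinuous_sliceLeft_snd, singularCohomology_map_const hi]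

/-- **The product class restricts to `η` on the slice `Y × {z₀}`: `(id, z₀)^*(pr_Y^* η + pr_Z^* η') = η`** (in any
positive degree; Birkenhake–Lange: `p₁^* L₁ ⊗ p₂^* L₂` restricts to `L₁` on `A₁ × {0}`). [cite: LangeBirkenhake1992, §5.3]
[cite: HatcherAT2002, §3.1 p. 199 and §3.2 Thm. 3.16] -/
theorem complexBetti_map_sliceLeft_map_fst_add_map_snd (z₀ : 𝟙_ (SchemeOver ℂ) ⟶ Z) {i : ℕ} (hi : i ≠ 0)
    (η : complexBetti Y i) (η' : complexBetti Z i) :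
    complexBetti.map (sliceLeft Y z₀) i (complexBetti.map (fst Y Z) i η + complexBetti.map (snd Y Z) i η') = η := by
  rw [map_add, complexBetti_map_sliceLeft_map_fst, complexBetti_map_sliceLeft_map_snd z₀ hi, add_zero]

/-- `(y₀, id)^* pr_Z^* b = b` on `Hⁱ(Z(ℂ); ℂ)`. [cite: HatcherAT2002, §3.2 Thm. 3.16 (p. 219)] -/
theorem complexBetti_map_sliceRight_map_snd (y₀ : 𝟙_ (SchemeOver ℂ) ⟶ Y) (i : ℕ) (b : complexBetti Z i) :
    complexBetti.map (sliceRight y₀ Z) i (complexBetti.map (snd Y Z) i b) = b := by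
  rw [← CategoryTheory.comp_apply, ← complexBetti.map_comp]
  unfold Motives.sliceRight
  rw [lift_snd, complexBetti.map_id]
  rfl

/-- `(y₀, id)^* pr_Y^* a = 0` on `Hⁱ(Y(ℂ); ℂ)` for `i ≠ 0`. [cite: HatcherAT2002, §3.1 p. 199 (dimension axiom)] -/
theorem complexBetti_map_sliceRight_map_fst (y₀ : 𝟙_ (SchemeOver ℂ) ⟶ Y) {i : ℕ} (hi : i ≠ 0) (a : complexBetti Y i) :
    complexBetti.map (sliceRight y₀ Z) i (complexBetti.map (fst Y Z) i a) = 0 := by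
  rw [← CategoryTheory.comp_apply]
  change (singularCohomology.map ℂ ℂ (AlgPoints.mapContinuous (L := ℂ) (fst Y Z)) i ≫
      singularCohomology.map ℂ ℂ (AlgPoints.mapContinuous (L := ℂ) (sliceRight y₀ Z)) i) a = 0
  rw [← singularCohomology.map_comp, mapContinuous_sliceRight_fst, singularCohomology_map_const hi]

/-- **The product class restricts to `η'` on the slice `{y₀} × Z`: `(y₀, id)^*(pr_Y^* η + pr_Z^* η') = η'`.**
[cite: LangeBirkenhake1992, §5.3] [cite: HatcherAT2002, §3.1 p. 199 and §3.2 Thm. 3.16] -/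
theorem complexBetti_map_sliceRight_map_fst_add_map_snd (y₀ : 𝟙_ (SchemeOver ℂ) ⟶ Y) {i : ℕ} (hi : i ≠ 0)
    (η : complexBetti Y i) (η' : complexBetti Z i) :
    complexBetti.map (sliceRight y₀ Z) i (complexBetti.map (fst Y Z) i η + complexBetti.map (snd Y Z) i η') = η' := by
  rw [map_add, complexBetti_map_sliceRight_map_fst y₀ hi, complexBetti_map_sliceRight_map_snd, zero_add]

/-- **The product class determines its factors**: for smooth projective `Y`, `Z` (so that both have rational points),
`pr_Y^* η₁ + pr_Z^* η₁' = pr_Y^* η₂ + pr_Z^* η₂'` in positive degree forces `η₁ = η₂` and `η₁' = η₂'`.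
[cite: LangeBirkenhake1992, §5.3] [cite: HatcherAT2002, §3.2 Thm. 3.16] -/
theorem eq_of_map_fst_add_map_snd_eq (hY : IsSmoothProjective m Y) (hZ : IsSmoothProjective n Z) {i : ℕ} (hi : i ≠ 0)
    {η₁ η₂ : complexBetti Y i} {η₁' η₂' : complexBetti Z i}
    (h : complexBetti.map (fst Y Z) i η₁ + complexBetti.map (snd Y Z) i η₁' =
      complexBetti.map (fst Y Z) i η₂ + complexBetti.map (snd Y Z) i η₂') : η₁ = η₂ ∧ η₁' = η₂' := by
  obtain ⟨z₀⟩ := nonempty_unitHom_of_isSmoothProjective hZ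
  obtain ⟨y₀⟩ := nonempty_unitHom_of_isSmoothProjective hY
  constructor
  · rw [← complexBetti_map_sliceLeft_map_fst_add_map_snd z₀ hi η₁ η₁', h,
      complexBetti_map_sliceLeft_map_fst_add_map_snd z₀ hi]
  · rw [← complexBetti_map_sliceRight_map_fst_add_map_snd y₀ hi η₁ η₁', h,
      complexBetti_map_sliceRight_map_fst_add_map_snd y₀ hi]

/-- **`β^*(pr_Z^* η' + pr_Y^* η) = pr_Y^* η + pr_Z^* η'`** for the braiding `β : Y × Z ≅ Z × Y` (`β ≫ pr_Z = pr_Z`,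
`β ≫ pr_Y = pr_Y`). [cite: HatcherAT2002, §3.2 Thm. 3.16] -/
theorem complexBetti_map_braiding_map_fst_add_map_snd {i : ℕ} (η : complexBetti Y i) (η' : complexBetti Z i) :
    complexBetti.map (β_ Y Z).hom i (complexBetti.map (fst Z Y) i η' + complexBetti.map (snd Z Y) i η) =
      complexBetti.map (fst Y Z) i η + complexBetti.map (snd Y Z) i η' := by
  rw [map_add, ← CategoryTheory.comp_apply, ← complexBetti.map_comp, braiding_hom_fst, ← CategoryTheory.comp_apply,
    ← complexBetti.map_comp, braiding_hom_snd, add_comm]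

end Slices

/-! ### §2 Hard Lefschetz of `pr_Y^* η + pr_Z^* η'` and of one factor forces hard Lefschetz of the other -/

section Converse

variable (hY : IsSmoothProjective m Y) (hZ : IsSmoothProjective n Z)
include hY hZ

/-- **The Lefschetz structure of `Y × Z` pulled back to `H*(Y) ⊗ H*(Z)` through the Künneth isomorphism** is the
tensor structure `(h_Y ⊗ 1 + 1 ⊗ h_Z, L_η ⊗ 1 + 1 ⊗ L_{η'})`: if `pr_Y^* η + pr_Z^* η'` has the hard Lefschetz property
in dimension `m + n` then `L_η ⊗ 1 + 1 ⊗ L_{η'}` has the Lefschetz property (`HasLefschetzProperty.conj` along `κ⁻¹`).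
[cite: LooijengaLunts1997, §1 (1.1) p. 4 L1–L5 and L70–L76] [cite: Andre1996Motifs, §1.3 (p. 12)] -/
theorem hasLefschetzProperty_tensor_of_map_fst_add_map_snd {η : complexBetti Y 2} {η' : complexBetti Z 2}
    (hθ : HasHardLefschetzProperty (complexBetti.map (fst Y Z) 2 η + complexBetti.map (snd Y Z) 2 η') (m + n)) :
    HasLefschetzProperty
      ((degreeOperator ℂ (ComplexPoints Y) m).rTensor (totalCohomology ℂ (ComplexPoints Z)) +
        (degreeOperator ℂ (ComplexPoints Z) n).lTensor (totalCohomology ℂ (ComplexPoints Y)))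
      ((totalLefschetz η).rTensor (totalCohomology ℂ (ComplexPoints Z)) +
        (totalLefschetz η').lTensor (totalCohomology ℂ (ComplexPoints Y))) := by
  have h1 := (hasLefschetzProperty_complexPoints (IsSmoothProjective.tensor_holds hY hZ) hθ).conj (kunnethEquiv hY hZ).symm
  rwa [← kunnethEquiv_conj_degreeOperator hY hZ, ← kunnethEquiv_conj_totalLefschetz hY hZ η η',
    LinearEquiv.conj_symm_conj, LinearEquiv.conj_symm_conj] at h1

/-- **Hard Lefschetz of the product class and of `η'` forces hard Lefschetz of `η`**: for `Y`, `Z` smooth projective of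
dimensions `m`, `n`, if `pr_Y^* η + pr_Z^* η'` has the hard Lefschetz property in dimension `m + n` and `η'` has it in
dimension `n`, then `η` has it in dimension `m` — Looijenga–Lunts' «closed under tensor products» in the converse
direction («a tensor factor of a Lefschetz module is a Lefschetz module», the tree's `HasLefschetzProperty.of_tensor`),
read on `H*((Y × Z)(ℂ); ℂ) ≅ H*(Y(ℂ); ℂ) ⊗ H*(Z(ℂ); ℂ)`. [cite: LooijengaLunts1997, §1 (1.1) p. 4 L1–L5, L62–L63, L70–L76]
[cite: CattaniElZeinGriffithsLe2014, App. A Def. A.2.5] [cite: HatcherAT2002, §3.2 Thm. 3.16] -/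
theorem hasHardLefschetzProperty_of_map_fst_add_map_snd_left {η : complexBetti Y 2} {η' : complexBetti Z 2}
    (hθ : HasHardLefschetzProperty (complexBetti.map (fst Y Z) 2 η + complexBetti.map (snd Y Z) 2 η') (m + n))
    (hη' : HasHardLefschetzProperty η' n) : HasHardLefschetzProperty η m := by
  haveI := finite_totalCohomology hY
  haveI := finite_totalCohomology hZ
  haveI := nontrivial_totalCohomology_complexPoints hZ
  exact hasHardLefschetzProperty_of_hasLefschetzProperty_totalLefschetz
    (HasLefschetzProperty.of_tensor (isZGrading_degreeOperator m) (isZGrading_degreeOperator n)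
      (mapsTo_of_lie_eq_two_nsmul (lie_degreeOperator_totalLefschetz m η))
      (hasLefschetzProperty_complexPoints hZ hη') (hasLefschetzProperty_tensor_of_map_fst_add_map_snd hY hZ hθ))

/-- **Hard Lefschetz of the product class and of `η` forces hard Lefschetz of `η'`** (the mirror statement, through
the braiding `Y × Z ≅ Z × Y`, along which hard Lefschetz transports, `HasHardLefschetzProperty.map_of_iso`).
[cite: LooijengaLunts1997, §1 (1.1) p. 4 L1–L5, L62–L63, L70–L76] [cite: HatcherAT2002, §3.2 Thm. 3.16] -/
theorem hasHardLefschetzProperty_of_map_fst_add_map_snd_right {η : complexBetti Y 2} {η' : complexBetti Z 2}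
    (hθ : HasHardLefschetzProperty (complexBetti.map (fst Y Z) 2 η + complexBetti.map (snd Y Z) 2 η') (m + n))
    (hη : HasHardLefschetzProperty η m) : HasHardLefschetzProperty η' n := by
  -- transport `θ` to `Z × Y`: `(β⁻¹)^* θ = pr_Z^* η' + pr_Y^* η`
  have h1 := hθ.map_of_iso (β_ Y Z).symm
  rw [Iso.symm_hom, ← complexBetti_map_braiding_map_fst_add_map_snd η η', Iso.complexBetti_map_inv_map_hom] at h1
  exact hasHardLefschetzProperty_of_map_fst_add_map_snd_left hZ hY (by rwa [Nat.add_comm] at h1) hη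

/-- **For `η'` hard Lefschetz, `pr_Y^* η + pr_Z^* η'` is hard Lefschetz iff `η` is.**
[cite: LooijengaLunts1997, §1 (1.1) p. 4 L62–L63, L70–L76] [cite: Andre1996Motifs, §1.3 (p. 12)] -/
theorem hasHardLefschetzProperty_map_fst_add_map_snd_iff_left {η : complexBetti Y 2} {η' : complexBetti Z 2}
    (hη' : HasHardLefschetzProperty η' n) :
    HasHardLefschetzProperty (complexBetti.map (fst Y Z) 2 η + complexBetti.map (snd Y Z) 2 η') (m + n) ↔
      HasHardLefschetzProperty η m :=
  ⟨fun hθ ↦ hasHardLefschetzProperty_of_map_fst_add_map_snd_left hY hZ hθ hη',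
    fun hη ↦ hasHardLefschetzProperty_map_fst_add_map_snd hY hZ hη hη'⟩

/-- **For `η` hard Lefschetz, `pr_Y^* η + pr_Z^* η'` is hard Lefschetz iff `η'` is.**
[cite: LooijengaLunts1997, §1 (1.1) p. 4 L62–L63, L70–L76] [cite: Andre1996Motifs, §1.3 (p. 12)] -/
theorem hasHardLefschetzProperty_map_fst_add_map_snd_iff_right {η : complexBetti Y 2} {η' : complexBetti Z 2}
    (hη : HasHardLefschetzProperty η m) :
    HasHardLefschetzProperty (complexBetti.map (fst Y Z) 2 η + complexBetti.map (snd Y Z) 2 η') (m + n) ↔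
      HasHardLefschetzProperty η' n :=
  ⟨fun hθ ↦ hasHardLefschetzProperty_of_map_fst_add_map_snd_right hY hZ hθ hη,
    fun hη' ↦ hasHardLefschetzProperty_map_fst_add_map_snd hY hZ hη hη'⟩

end Converse

/-! ### §3 Polarization classes: the product class is a polarization class iff the factors are -/

section Polarization

variable (hY : IsSmoothProjective m Y) (hZ : IsSmoothProjective n Z)
include hY hZ

/-- **If `pr_Y^* η + pr_Z^* η'` is a polarization class of `Y × Z` and `η'` is hard Lefschetz, then `η` is a
polarization class of `Y`**: `η` is the restriction `(id, z₀)^* θ` to a slice, hence rational and supported on a divisor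
(pull-back of a divisor class along `Y ⟶ Y × Z`, `map_mem_algebraicClasses_one`), and hard Lefschetz by §2.
[cite: LangeBirkenhake1992, §5.3] [cite: LooijengaLunts1997, §1 (1.1) p. 4 L62–L63, L70–L76]
[cite: VoisinHodgeI2002, Thm. 11.30 and §7.1.2] -/
theorem IsPolarizationClass.of_tensor_left {η : complexBetti Y 2} {η' : complexBetti Z 2}
    (hθ : IsPolarizationClass (m + n) (Y ⊗ Z) (complexBetti.map (fst Y Z) 2 η + complexBetti.map (snd Y Z) 2 η'))
    (hη' : HasHardLefschetzProperty η' n) : IsPolarizationClass m Y η := by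
  obtain ⟨z₀⟩ := nonempty_unitHom_of_isSmoothProjective hZ
  have hres := complexBetti_map_sliceLeft_map_fst_add_map_snd z₀ two_ne_zero η η'
  refine ⟨?_, ?_, hasHardLefschetzProperty_of_map_fst_add_map_snd_left hY hZ hθ.hasHardLefschetz hη'⟩
  · rw [← hres]
    exact hθ.isRationalClass.pullback _
  · rw [← hres]
    exact map_mem_algebraicClasses_one (IsSmoothProjective.tensor_holds hY hZ) hY (sliceLeft Y z₀) hθ.mem_algebraicClasses

/-- **If `pr_Y^* η + pr_Z^* η'` is a polarization class of `Y × Z` and `η` is hard Lefschetz, then `η'` is a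
polarization class of `Z`.** [cite: LangeBirkenhake1992, §5.3] [cite: LooijengaLunts1997, §1 (1.1) p. 4 L62–L63, L70–L76]
[cite: VoisinHodgeI2002, Thm. 11.30 and §7.1.2] -/
theorem IsPolarizationClass.of_tensor_right {η : complexBetti Y 2} {η' : complexBetti Z 2}
    (hθ : IsPolarizationClass (m + n) (Y ⊗ Z) (complexBetti.map (fst Y Z) 2 η + complexBetti.map (snd Y Z) 2 η'))
    (hη : HasHardLefschetzProperty η m) : IsPolarizationClass n Z η' := by
  obtain ⟨y₀⟩ := nonempty_unitHom_of_isSmoothProjective hY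
  have hres := complexBetti_map_sliceRight_map_fst_add_map_snd y₀ two_ne_zero η η'
  refine ⟨?_, ?_, hasHardLefschetzProperty_of_map_fst_add_map_snd_right hY hZ hθ.hasHardLefschetz hη⟩
  · rw [← hres]
    exact hθ.isRationalClass.pullback _
  · rw [← hres]
    exact map_mem_algebraicClasses_one (IsSmoothProjective.tensor_holds hY hZ) hZ (sliceRight y₀ Z) hθ.mem_algebraicClasses

/-- **For `η'` a polarization class of `Z`: `pr_Y^* η + pr_Z^* η'` is a polarization class of `Y × Z` iff `η` is a
polarization class of `Y`.** [cite: LangeBirkenhake1992, §5.3] [cite: Andre1996Motifs, §1.3 (p. 12)]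
[cite: LooijengaLunts1997, §1 (1.1) p. 4 L62–L63, L70–L76] -/
theorem isPolarizationClass_map_fst_add_map_snd_iff_left {η : complexBetti Y 2} {η' : complexBetti Z 2}
    (hη' : IsPolarizationClass n Z η') :
    IsPolarizationClass (m + n) (Y ⊗ Z) (complexBetti.map (fst Y Z) 2 η + complexBetti.map (snd Y Z) 2 η') ↔
      IsPolarizationClass m Y η :=
  ⟨fun hθ ↦ hθ.of_tensor_left hY hZ hη'.hasHardLefschetz, fun hη ↦ hη.tensor hY hZ hη'⟩

/-- **For `η` a polarization class of `Y`: `pr_Y^* η + pr_Z^* η'` is a polarization class of `Y × Z` iff `η'` is a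
polarization class of `Z`.** [cite: LangeBirkenhake1992, §5.3] [cite: Andre1996Motifs, §1.3 (p. 12)]
[cite: LooijengaLunts1997, §1 (1.1) p. 4 L62–L63, L70–L76] -/
theorem isPolarizationClass_map_fst_add_map_snd_iff_right {η : complexBetti Y 2} {η' : complexBetti Z 2}
    (hη : IsPolarizationClass m Y η) :
    IsPolarizationClass (m + n) (Y ⊗ Z) (complexBetti.map (fst Y Z) 2 η + complexBetti.map (snd Y Z) 2 η') ↔
      IsPolarizationClass n Z η' :=
  ⟨fun hθ ↦ hθ.of_tensor_right hY hZ hη.hasHardLefschetz, fun hη' ↦ hη.tensor hY hZ hη'⟩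

end Polarization

end Literature.AlgebraicGeometry.HodgeTheory

end
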